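/-
Copyright (c) 2026 the pub-hodgecm-mathlib formalisation cell (harness21).  Prover seat hodgecm-mathlib-K2Liu-p09 (g2): Track B «K2-LIT», #184♮ = hLiu418,
preliminaries for file #34 `Theorems/K2LiuDoublingZetaGL1.lean` (the by-name payer of tier-0 `stub_doublingZetaGL1`, LEAD F0P6-plan (g10) DEAL K2/STATUS
2026-09-04T02:36:29Z, dictionary DEPMAP v2.5 §10 (K2Liu-plan (g2))).
-/
import Literature.NumberTheory.K2Lit.DoublingZetaIntegral
import Literature.NumberTheory.Automorphic.AutomorphicSpectrum
import Literature.NumberTheory.Automorphic.PairLFunctionBaseChange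
import Mathlib.Analysis.Complex.Convex
import HarnessLib

/-!
# Crux `HLiu418`, Track B road `K2_Liu`, file #34 `K2LiuDoublingZetaGL1` — PRELIMINARIES (payer-internal steps (ae), (K), (ψ)-index set, (cv)-domain of DEPMAP v2.5 §10)

Cell `hodgecm-mathlib`, crux item hLiu418 = `stmt-HodgeConjecture-24832`, route of record `HCCMUnconditional`; squad K2 ∕ K2Liu, LEAD F0P6-plan (g10),
prover K2Liu-p09 (g2).  THEOREMS ONLY (no `def`, no instance, no notation, no named-fact hypothesis, no `sorry`, default heartbeats); lane
`--supports stmt-HodgeConjecture-24832 --as helper` (count-neutral).  Generic statements (any `AdelicGroupData`, any extension `E ∕ F`), so that the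
CM payer #34 only instantiates them.

WHAT IS PROVED (each a row of the #34 dictionary, DEPMAP v2.5 §10 TABLES B∕C):
* §1 `finite_setOf_under_mem` — the index set of s23's partial `GL₁` product, `S_L := {w ∣ w.under 𝓞F ∈ S}` for an `F`-finset `S`, is FINITE
  (★ `finite_placesOver`; TABLE B row `ψ … S`).
* §2 (ae)∕(K) `quotMatrixCoeff_congr_ae`, `quotMatrixCoeff_eq_integral_rightRegular`, `quotMatrixCoeff_mul_eq_of_rightRegular_apply_eq` — the matrix
  coefficient `⟨π(g)φ₁, φ₂⟩ = ∫ φ₁(g⁻¹ • x) conj(φ₂ x) dμ` (★ `K2Lit.SiegelDoubled.quotMatrixCoeff`) sees `φ₁` only through its `μ`-a.e. class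
  (the action preserves `μ`), equals `∫ (R g f)(x) conj(φ₂ x) dμ` for any `L²` class `f =ᵐ φ₁` (★ `rightRegular_apply_coeFn`), and is therefore
  right-invariant under every `k` FIXING `f` in `L²`: `⟨π(t k)φ₁, φ₂⟩ = ⟨π(t)φ₁, φ₂⟩` — this turns ★ #33w's `P.space.toContRep k w = w` into #29s's
  hypothesis (K) for the continuous companion `wc` (TABLE B row `w`, TABLE C (ae)).
* §3 `norm_mul_self_conj`, `conj_mul_mul_of_norm_eq_one` — `conj c · (c · z) = z` for `‖c‖ = 1` (the (u)-cancellation of the `s`-twist, TABLE B row `w'`).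
* §4 `domain_re_pos` — `U := {s ∣ 0 < re s}` is open, convex, contains `1∕2` and `{s ∣ s₁ < re s}` for `1 ≤ s₁` (TABLE B row `r U s₁`).

HONEST LABEL: HC_CM is proved only modulo the printed citations (2 remaining named inputs: hLiu418 = stmt-HodgeConjecture-24832,
h413 = stmt-HodgeConjecture-24833) until rung 0 closes; this file is generic bookkeeping toward socket s23 and closes no item.
-/

set_option autoImplicit false
set_option linter.dupNamespace false

noncomputable section

open NumberField IsDedekindDomain MeasureTheory
open scoped ComplexConjugate

namespace Summit.HodgeConjecture.HodgeConjecture.Cruxes.HLiu418.K2LiuDoublingZetaGL1Prelim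

open Literature.NumberTheory.Automorphic

/-! ## §1 The index set `S_L = {w ∣ w ∩ 𝓞F ∈ S}` is finite -/

section Places

variable {F E : Type} [Field F] [NumberField F] [Field E] [NumberField E] [Algebra F E]

/-- For a finite set `S` of finite places of `F`, the set of finite places `w` of `E` lying over a place of `S` is finite (finitely many
places over each `v`, ★ `finite_placesOver` = `IsDedekindDomain.primesOver_finite`). [folklore] -/
theorem finite_setOf_under_mem (S : Finset (HeightOneSpectrum (𝓞 F))) :
    {w : HeightOneSpectrum (𝓞 E) | w.under (𝓞 F) ∈ S}.Finite := by
  have h : {w : HeightOneSpectrum (𝓞 E) | w.under (𝓞 F) ∈ S} =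
      ⋃ v ∈ (S : Set (HeightOneSpectrum (𝓞 F))), {w : HeightOneSpectrum (𝓞 E) | w.under (𝓞 F) = v} := by
    ext w
    simp
  rw [h]
  refine Set.Finite.biUnion S.finite_toSet fun v _ => ?_
  exact Set.finite_coe_iff.mp (finite_placesOver (F := F) (E := E) v)

end Places

/-! ## §2 The matrix coefficient sees slot 1 only through its `L²` class; right-invariance under the fixator -/

section Quot

variable {K : Type} [Field K] [NumberField K] (𝒢 : AdelicGroupData.{0} K)
  (μ : Measure 𝒢.automorphicQuotient) [SMulInvariantMeasure 𝒢.Adelic 𝒢.automorphicQuotient μ]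

/-- `⟨π(g)φ₁, φ₂⟩` depends on `φ₁` only through its `μ`-a.e. class: the translation `x ↦ g⁻¹ • x` preserves `μ`.
[cite: Liu2021, §B.3 (B.7) p. 101] -/
theorem quotMatrixCoeff_congr_ae {φ₁ φ₁' : 𝒢.automorphicQuotient → ℂ} (h : φ₁ =ᵐ[μ] φ₁')
    (φ₂ : 𝒢.automorphicQuotient → ℂ) (g : 𝒢.Adelic) :
    Literature.NumberTheory.K2Lit.SiegelDoubled.quotMatrixCoeff 𝒢 μ φ₁ φ₂ g =
      Literature.NumberTheory.K2Lit.SiegelDoubled.quotMatrixCoeff 𝒢 μ φ₁' φ₂ g := by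
  unfold Literature.NumberTheory.K2Lit.SiegelDoubled.quotMatrixCoeff
  refine integral_congr_ae ?_
  have hq : (fun x => φ₁ (g⁻¹ • x)) =ᵐ[μ] fun x => φ₁' (g⁻¹ • x) :=
    (measurePreserving_smul g⁻¹ μ).quasiMeasurePreserving.ae_eq_comp h
  filter_upwards [hq] with x hx
  rw [hx]

/-- `⟨π(g)φ₁, φ₂⟩ = ∫ (R g f)(x) conj(φ₂ x) dμ` for every `L²` class `f` with `f =ᵐ φ₁` (`(R g f)(x) = f(g⁻¹ • x)` a.e., ★ `rightRegular_apply_coeFn`).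
[cite: Liu2021, §B.3 (B.7) p. 101] -/
theorem quotMatrixCoeff_eq_integral_rightRegular (f : 𝒢.L2 μ) {φ₁ : 𝒢.automorphicQuotient → ℂ}
    (hf : ((f : 𝒢.L2 μ) : 𝒢.automorphicQuotient → ℂ) =ᵐ[μ] φ₁) (φ₂ : 𝒢.automorphicQuotient → ℂ) (g : 𝒢.Adelic) :
    Literature.NumberTheory.K2Lit.SiegelDoubled.quotMatrixCoeff 𝒢 μ φ₁ φ₂ g =
      ∫ x, ((𝒢.rightRegular μ g f : 𝒢.L2 μ) : 𝒢.automorphicQuotient → ℂ) x * conj (φ₂ x) ∂μ := by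
  rw [quotMatrixCoeff_congr_ae 𝒢 μ hf.symm φ₂ g]
  unfold Literature.NumberTheory.K2Lit.SiegelDoubled.quotMatrixCoeff
  refine integral_congr_ae ?_
  filter_upwards [𝒢.rightRegular_apply_coeFn μ g f] with x hx
  rw [hx]

/-- **(K) from an `L²` fixed vector.**  If `R k f = f` in `L²` and `f =ᵐ φ₁`, then `⟨π(t k)φ₁, φ₂⟩ = ⟨π(t)φ₁, φ₂⟩` for every `t` — the scalar
`K^S`-sphericity hypothesis (K) of ★ #29s `doublingPartialEuler` for the continuous companion of ★ #33w's `K^S_G`-fixed vector.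
[cite: Liu2021, §B.3 (B.7) p. 101] -/
theorem quotMatrixCoeff_mul_eq_of_rightRegular_apply_eq (f : 𝒢.L2 μ) {φ₁ : 𝒢.automorphicQuotient → ℂ}
    (hf : ((f : 𝒢.L2 μ) : 𝒢.automorphicQuotient → ℂ) =ᵐ[μ] φ₁) {k : 𝒢.Adelic} (hk : 𝒢.rightRegular μ k f = f)
    (φ₂ : 𝒢.automorphicQuotient → ℂ) (t : 𝒢.Adelic) :
    Literature.NumberTheory.K2Lit.SiegelDoubled.quotMatrixCoeff 𝒢 μ φ₁ φ₂ (t * k) =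
      Literature.NumberTheory.K2Lit.SiegelDoubled.quotMatrixCoeff 𝒢 μ φ₁ φ₂ t := by
  have hmul : 𝒢.rightRegular μ (t * k) f = 𝒢.rightRegular μ t f := by
    rw [map_mul]
    exact congrArg (𝒢.rightRegular μ t) hk
  rw [quotMatrixCoeff_eq_integral_rightRegular 𝒢 μ f hf φ₂ (t * k), quotMatrixCoeff_eq_integral_rightRegular 𝒢 μ f hf φ₂ t, hmul]

/-- **(K) for a closed subrepresentation.**  Same as `quotMatrixCoeff_mul_eq_of_rightRegular_apply_eq` with the fixed vector living in a closed
`G(𝔸)`-stable subspace `W ⊆ L²` (e.g. ★ `DiscreteAutomorphicRep.space`): `W.toContRep k w = w` ⇒ `⟨π(t k)φ₁, φ₂⟩ = ⟨π(t)φ₁, φ₂⟩` for `w =ᵐ φ₁`.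
[cite: Liu2021, §B.3 (B.7) p. 101] -/
theorem quotMatrixCoeff_mul_eq_of_toContRep_apply_eq (W : ContRepresentation.ClosedSubrep (𝒢.rightRegular μ)) (w : W.toSubmodule)
    {φ₁ : 𝒢.automorphicQuotient → ℂ} (hw : (((w : 𝒢.L2 μ)) : 𝒢.automorphicQuotient → ℂ) =ᵐ[μ] φ₁) {k : 𝒢.Adelic}
    (hk : W.toContRep k w = w) (φ₂ : 𝒢.automorphicQuotient → ℂ) (t : 𝒢.Adelic) :
    Literature.NumberTheory.K2Lit.SiegelDoubled.quotMatrixCoeff 𝒢 μ φ₁ φ₂ (t * k) =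
      Literature.NumberTheory.K2Lit.SiegelDoubled.quotMatrixCoeff 𝒢 μ φ₁ φ₂ t := by
  refine quotMatrixCoeff_mul_eq_of_rightRegular_apply_eq 𝒢 μ (w : 𝒢.L2 μ) hw ?_ φ₂ t
  have h := congrArg (fun v : W.toSubmodule => (v : 𝒢.L2 μ)) hk
  simpa only [ContRepresentation.ClosedSubrep.coe_toContRep_apply] using h

end Quot

/-! ## §3 The unitary twist cancels -/

/-- `‖c‖ = 1 ⇒ conj c * c = 1`. [folklore] -/
theorem conj_mul_self_of_norm_eq_one {c : ℂ} (hc : ‖c‖ = 1) : conj c * c = 1 := by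
  rw [Complex.conj_mul', hc]
  simp

/-- `‖c‖ = 1 ⇒ conj c * (c * z) = z` — the (u)-step of the #34 dictionary: the `s`-twist `twistD_s` of slot 2 (`|twistD_s| = 1`, ★
`K2LiuDoublingUnfoldTwist.siegelDeltaCharacter_iotaV_diag` + ★ `isUnitary_toHeckeCharacter`) cancels against the conjugate twist produced by ★ #13's
unfolding, leaving the `s`-free vector `w'`. [folklore] -/
theorem conj_mul_mul_of_norm_eq_one {c : ℂ} (hc : ‖c‖ = 1) (z : ℂ) : conj c * (c * z) = z := by
  rw [← mul_assoc, conj_mul_self_of_norm_eq_one hc, one_mul]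

/-! ## §4 The continuation domain `U = {0 < re}` -/

/-- `U := {s ∣ 0 < re s}` is open and convex, contains `1∕2`, and contains the half-plane `{s ∣ s₁ < re s}` for every `1 ≤ s₁` (indeed for
`0 ≤ s₁`) — the domain clauses of s23's `r U s₁`. [folklore] -/
theorem domain_re_pos (s₁ : ℝ) (hs₁ : 1 ≤ s₁) :
    IsOpen {s : ℂ | 0 < s.re} ∧ Convex ℝ {s : ℂ | 0 < s.re} ∧ (1 / 2 : ℂ) ∈ {s : ℂ | 0 < s.re} ∧
      {s : ℂ | s₁ < s.re} ⊆ {s : ℂ | 0 < s.re} := by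
  refine ⟨isOpen_lt continuous_const Complex.continuous_re, convex_halfSpace_re_gt 0, ?_, fun s hs => ?_⟩
  · simp
  · have h : s₁ < s.re := hs
    show 0 < s.re
    linarith

end Summit.HodgeConjecture.HodgeConjecture.Cruxes.HLiu418.K2LiuDoublingZetaGL1Prelim

end
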